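import Summits.CriticalPhenomena.PercolationContinuityZ3.Theorems.PercNearOneGluingNoHeavyLowerTailSahiMixtureFourCellsK0
import Summits.CriticalPhenomena.PercolationContinuityZ3.Theorems.PercNearOneGluingNoHeavyLowerTailSahiMixtureFourCellsK1
import Summits.CriticalPhenomena.PercolationContinuityZ3.Theorems.PercNearOneGluingNoHeavyLowerTailSahiMixtureFourCellsK2
import Summits.CriticalPhenomena.PercolationContinuityZ3.Theorems.PercNearOneGluingNoHeavyLowerTailSahiMixtureFourCellsK3
import Summits.CriticalPhenomena.PercolationContinuityZ3.Theorems.PercNearOneGluingNoHeavyLowerTailSahiMixtureOrThreeOfFour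

/-!
# H-MIX(4) IS A THEOREM: the hereditary class of four events is preserved, Bernstein-positively, under OR-ing an independent coin
# into any sub-collection

Support file of the one-cut programme (crux `NoHeavyLowerTail`, stmt-CriticalPhenomena-4575; cell `prim-masterthm`, seat P3, gen 7;
`run/shared/lean/prim/prim-masterthm/prim-masterthm-p3/HIERARCHY.md` §14).  The hereditary mixture conjecture H-MIX
(`…SahiMixtureHereditary.HereditaryMixturePositivity`, this seat gen 5/6) is FALSE in general (six events, `…SahiMixtureHereditaryRefutation`), but its
four-event case holds:

**`hereditaryMixture_four`** — for every probability weight `μ` on a finite type, every quadruple `A : Fin 4 → Set α` in the hereditary class `𝒦₄`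
(`HereditaryAllOrders μ A`: the ∩-closed family is Sahi-nonnegative at every order), every `F : Fin 4 → Bool` and every multiset `K : Fin m → Finset (Fin 4)`
of index sets, `h ↦ E_m(μ⊗coin(h); (1_{⋂_{i∈K_j}(A_i ∪ [F i]·H)})_j)` is Bernstein-positive of degree `m`; hence (`hereditaryAllOrders_orCoin_four`) the
OR-mixed quadruple is again in `𝒦₄` for every bias `h ∈ [0,1]`, and (`hereditaryMixturePositivity_four`) the conjecture restricted to `n = 4` holds.

Assembly: `…SahiMixtureHMixFourCanon.hereditaryMixture_four_of_canonCells` (uncovered ⇒ irredundant ⇒ `m ≤ 4`; singleton cells; canonical form of the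
three-slot cells) fed with the four canonical three-slot families `…SahiMixtureFourCellsK{0,1,2,3}` (34 certified cells replaying ttrl cp-mix's
hereditary certificates `certs/her3`, re-solved for sparsity on ttrl kit j101914, and 30 plain cells) and the three-of-four cell
`…SahiMixtureOrThreeOfFour.orThreeOfFourCell_holds` (cp-mix F012-HER, kit j102318).  HONEST FRAMING: a theorem about four events and the law-level
hereditary class; H-MIX(5) is open, H-MIX(6) false; nothing here is Sahi's conjecture `C_k` or the percolation crux. [this work]
-/

noncomputable section

open scoped Classical

namespace Summit.CriticalPhenomena.PercolationContinuityZ3.Theorems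

open Finset Function
open Literature.Combinatorics.Sahi2008
open Literature.Probability.Percolation.DecisionTree (ind ind_of_mem ind_of_not_mem ind_nonneg)

namespace SahiMixture

/-- All four canonical three-slot families hold. [this work] -/
theorem canonThreeSlotCells_all : ∀ k : Fin 4, CanonThreeSlotCells k := by
  intro k
  fin_cases k
  · exact canonThreeSlotCells_zero
  · exact canonThreeSlotCells_one
  · exact canonThreeSlotCells_two
  · exact canonThreeSlotCells_three

section Main

variable {α : Type} [Fintype α] {μ : α → ℝ} (hμ : ∀ a, 0 ≤ μ a) (hμ1 : ∑ a, μ a = 1)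
include hμ hμ1

/-- **H-MIX(4).**  For a hereditarily all-orders-positive quadruple, every row of the ∩-closed family of the OR-mixed events
`A_i ∪ [F i]·H` is Bernstein-positive of its degree in the bias of the independent coin `H`. [this work] -/
theorem hereditaryMixture_four (A : Fin 4 → Set α) (F : Fin 4 → Bool) (hA : HereditaryAllOrders μ A) (m : ℕ)
    (K : Fin m → Finset (Fin 4)) :
    BernsteinPos m (fun h => sahiE (coinWeight μ h) m (fun j => ind (⋂ i ∈ K j, orCoin (A i) (F i)))) :=
  hereditaryMixture_four_of_canonCells hμ hμ1 canonThreeSlotCells_all orThreeOfFourCell_holds A F hA m K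

/-- **`𝒦₄` is preserved under OR-mixing**: for every bias `h ∈ [0,1]` the OR-mixed quadruple is hereditarily all-orders positive under `μ ⊗ coin(h)`.
[this work] -/
theorem hereditaryAllOrders_orCoin_four (A : Fin 4 → Set α) (F : Fin 4 → Bool) (hA : HereditaryAllOrders μ A) {h : ℝ} (h0 : 0 ≤ h)
    (h1 : h ≤ 1) : HereditaryAllOrders (coinWeight μ h) (fun i => orCoin (A i) (F i)) :=
  fun m K => (hereditaryMixture_four hμ hμ1 A F hA m K).nonneg h0 h1

end Main

/-- **The hereditary mixture conjecture restricted to four events holds** (the `n = 4` instance of `HereditaryMixturePositivity`). [this work] -/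
theorem hereditaryMixturePositivity_four :
    ∀ (α : Type) [Fintype α] (μ : α → ℝ), (∀ a, 0 ≤ μ a) → ∑ a, μ a = 1 →
      ∀ (A : Fin 4 → Set α) (F : Fin 4 → Bool), HereditaryAllOrders μ A →
        ∀ (m : ℕ) (K : Fin m → Finset (Fin 4)),
          BernsteinPos m (fun h => sahiE (coinWeight μ h) m (fun j => ind (⋂ i ∈ K j, orCoin (A i) (F i)))) :=
  fun _ _ _ hμ hμ1 A F hA m K => hereditaryMixture_four hμ hμ1 A F hA m K

end SahiMixture

end Summit.CriticalPhenomena.PercolationContinuityZ3.Theorems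

end
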